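import Mathlib.Combinatorics.SimpleGraph.Paths
import Mathlib.Combinatorics.SimpleGraph.Finite
import Mathlib.Combinatorics.SimpleGraph.Walk.Decomp
import Mathlib.Combinatorics.SimpleGraph.Walk.Subwalks
import Mathlib.Analysis.SpecialFunctions.Pow.Real
import HarnessLib

/-!
# Bondy–Simonovits 1974 — Lemma 1: θ-graphs and `t`-periodic colourings

Fully proved infrastructure for the discharge of the named fact
`Literature.Combinatorics.SimpleGraph.BondySimonovits1974_thm1` (Theorem 1 of [BondySimonovits1974],
file `BondySimonovits.lean`; the discharge itself is `BondySimonovits1974_thm1_holds` there). This file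
contains the combinatorial core and **Lemma 1** of the paper (p. 99): *"Let `t` be a positive integer,
and let `G` be a connected graph for which `e(G) > 2t·v(G)`. Then the number of colours in any
`t`-periodic colouring of `G` is at most two"* — a colouring being `t`-periodic when the end-vertices
of every (simple) path of length `t` have the same colour.

Rendering and design choices (the printed proof is followed step by step; deviations are noted).
* Everything is RELATIVE to an ambient `G : SimpleGraph V` on a `Fintype` and a vertex set
  `S : Finset V`: "the subgraph spanned by `S`" is never built as a graph on a subtype; instead we use
  walks/paths of `G` *supported in `S`* (`∀ x ∈ p.support, x ∈ S`), inner degrees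
  `#(G.neighborFinset v ∩ S)` and the inner-degree sum `Σ_{w ∈ S} #(N(w) ∩ S) = 2·e(G[S])`.
* The hypothesis `e > 2t·v` is used in the paper (proof of (i), p. 99) only to pass, by deleting
  vertices of small valence, to a part of minimum valence `≥ 2t`. That step is packaged once and for
  all as the **minimal core** `exists_core`: a subset `S ⊆ U` of minimal size with
  `a·|S| < b·Σ_{w∈S} deg_S(w)` has all inner degrees `> a/(2b)` AND is connected through `S` (a
  disconnected `S` would split the inequality). Lemma 1 (`lemma1`) is then stated directly under
  "every vertex of `S` has `≥ 2t + 1` neighbours in `S`, and `S` is connected through `S`".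
* (i) `exists_theta` is Pósa's longest-path argument as printed: the first vertex `x₁` of a longest
  `S`-path has all its `≥ 2t+1` `S`-neighbours on the path, at indices `i₁ < i₂ < …`; with `A = iₜ ≥ t`
  and `B ≥ A + t` we take the cycle `x₁ … x_B x₁` with the chord `x₁ x_A`. The θ-graph is rendered as
  an `L`-periodic map `F : ℤ → V` (`L = B + 1`), injective on a period, with `F z ~ F (z+1)` and the
  chord `F 0 ~ F a`, `t ≤ a`, `a + t ≤ L`.
* (ii) `theta_two_colours`: instead of "any period on one cycle induces the same period on the other
  cycles" we compute with residues (`two_values_of_shifts`): along the long cycle the colour is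
  `t`- and `L`-periodic, hence `gcd(t, L)`-periodic, and the two families of paths of length `t`
  through the chord (`j, j−1, …, 0, a, a−1, …` and `−j, …, 0, a, a+1, …`) shift residues by `a + 1`
  and by `a − 1`; so the colour is `2`-periodic and takes only the values at `F 0`, `F 1`.
* (iii) `lemma1`: every vertex of `S` is joined to the θ-graph by a shortest `S`-walk; prolonged along
  the cycle to a length `≡ 0 (mod t)` it is still a path, and colours propagate along it `t` steps
  at a time (`colour_eq_of_length_mul`), exactly as in the paper.
* Generic tools proved here and reused by the Lemma-2 file: `exists_path_of_chain` (a walk/path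
  traced by a chain `g 0 ~ g 1 ~ ⋯ ~ g n`), `colour_eq_of_length_mul`, `sum_innerDeg_erase`.

Nothing here is a named fact: every declaration is a theorem (D-0026).

## References

* J. A. Bondy, M. Simonovits, *Cycles of even length in graphs*, J. Combin. Theory Ser. B 16
  (1974) 97–105, doi:10.1016/0095-8956(74)90052-5 — Lemma 1, pp. 99–100 (READ, held
  `paper:doi-10-1016-0095-8956-74-90052-5`). [BondySimonovits1974]
-/

namespace Literature.Combinatorics.SimpleGraph

namespace BondySimonovits1974

open Finset _root_.SimpleGraph

variable {V : Type*} [Fintype V] [DecidableEq V] {G : _root_.SimpleGraph V} [DecidableRel G.Adj]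

/-! ## Inner degrees and the minimal core -/

/-- Inner-degree sum identity: deleting a vertex `v` from `S` removes exactly `2·deg_S(v)` from
the sum of the inner degrees `Σ_{w ∈ S} |N(w) ∩ S|` (twice the number of edges inside `S`).
[folklore] -/
theorem sum_innerDeg_erase (S : Finset V) {v : V} (hv : v ∈ S) :
    ∑ w ∈ S.erase v, (G.neighborFinset w ∩ S.erase v).card + 2 * (G.neighborFinset v ∩ S).card
      = ∑ w ∈ S, (G.neighborFinset w ∩ S).card := by
  have key : ∀ w ∈ S.erase v, (G.neighborFinset w ∩ S).card
      = (G.neighborFinset w ∩ S.erase v).card + (if G.Adj w v then 1 else 0) := by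
    intro w hw
    rw [Finset.inter_erase]
    by_cases hadj : G.Adj w v
    · rw [if_pos hadj]
      have hmem : v ∈ G.neighborFinset w ∩ S := by simp [hadj, hv]
      rw [Finset.card_erase_add_one hmem]
    · rw [if_neg hadj, add_zero]
      have hmem : v ∉ G.neighborFinset w ∩ S := by simp [hadj]
      rw [Finset.erase_eq_of_notMem hmem]
  have hind : ∑ w ∈ S.erase v, (if G.Adj w v then 1 else 0) = (G.neighborFinset v ∩ S).card := by
    rw [Finset.sum_boole]
    simp only [Nat.cast_id]
    congr 1
    ext w
    simp only [Finset.mem_filter, Finset.mem_erase, Finset.mem_inter, mem_neighborFinset]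
    constructor
    · rintro ⟨⟨_, hwS⟩, hadj⟩
      exact ⟨hadj.symm, hwS⟩
    · rintro ⟨hadj, hwS⟩
      exact ⟨⟨by rintro rfl; exact G.irrefl hadj, hwS⟩, hadj.symm⟩
  rw [← Finset.add_sum_erase S _ hv, Finset.sum_congr rfl key, Finset.sum_add_distrib, hind]
  ring

/-- **Minimal core.** If `a·|U| < b·Σ_{w∈U} deg_U(w)` then a subset `S ⊆ U` of minimal size with the
same property has all inner degrees `> a/(2b)` and is connected through walks staying inside `S`.
(The standard "delete a vertex of small degree" argument, run to the end.) [folklore] -/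
theorem exists_core (a b : ℕ) (U : Finset V)
    (hU : a * U.card < b * ∑ w ∈ U, (G.neighborFinset w ∩ U).card) :
    ∃ S ⊆ U, a * S.card < b * ∑ w ∈ S, (G.neighborFinset w ∩ S).card ∧
      (∀ v ∈ S, a < 2 * b * (G.neighborFinset v ∩ S).card) ∧
      (∀ u ∈ S, ∀ v ∈ S, ∃ p : G.Walk u v, ∀ x ∈ p.support, x ∈ S) := by
  classical
  set good : Finset (Finset V) :=
    U.powerset.filter (fun S => a * S.card < b * ∑ w ∈ S, (G.neighborFinset w ∩ S).card)
    with hgood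
  have hUg : U ∈ good := by simp [hgood, hU]
  obtain ⟨S, hS, hmin⟩ := Finset.exists_min_image good Finset.card ⟨U, hUg⟩
  simp only [hgood, Finset.mem_filter, Finset.mem_powerset] at hS hmin
  obtain ⟨hSU, hSa⟩ := hS
  refine ⟨S, hSU, hSa, ?_, ?_⟩
  · intro v hv
    by_contra hlt
    push Not at hlt
    have hid := sum_innerDeg_erase (G := G) S hv
    have hcard : (S.erase v).card = S.card - 1 := Finset.card_erase_of_mem hv
    have hpos : 1 ≤ S.card := Finset.card_pos.mpr ⟨v, hv⟩
    have hgood' : a * (S.erase v).card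
        < b * ∑ w ∈ S.erase v, (G.neighborFinset w ∩ S.erase v).card := by
      rw [hcard]
      have h1 : a * (S.card - 1) = a * S.card - a := Nat.mul_sub_one a S.card
      rw [h1]
      have h2 : b * ∑ w ∈ S, (G.neighborFinset w ∩ S).card
          = b * ∑ w ∈ S.erase v, (G.neighborFinset w ∩ S.erase v).card
            + 2 * b * (G.neighborFinset v ∩ S).card := by
        rw [← hid]; ring
      have h3 : a ≤ a * S.card := Nat.le_mul_of_pos_right a hpos
      omega
    have := hmin (S.erase v) ⟨(Finset.erase_subset v S).trans hSU, hgood'⟩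
    omega
  · intro u hu v hv
    by_contra hno
    set P : V → Prop := fun w => ∃ p : G.Walk u w, ∀ x ∈ p.support, x ∈ S with hP
    have hPu : P u := ⟨Walk.nil, by simp [hu]⟩
    have hPv : ¬ P v := fun ⟨p, hp⟩ => hno ⟨p, hp⟩
    -- closure of `P` under edges inside `S`
    have hcl : ∀ w y, P w → y ∈ S → G.Adj w y → P y := by
      rintro w y ⟨p, hp⟩ hy hadj
      refine ⟨p.concat hadj, ?_⟩
      intro x hx
      rw [Walk.support_concat] at hx
      rcases List.mem_append.mp hx with hx | hx
      · exact hp x hx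
      · simp only [List.mem_singleton] at hx
        exact hx ▸ hy
    -- inner degrees split along the partition `S = S.filter P ∪ S.filter ¬P`
    have hdeg1 : ∀ w ∈ S.filter P, (G.neighborFinset w ∩ S).card
        = (G.neighborFinset w ∩ S.filter P).card := by
      intro w hw
      rw [Finset.mem_filter] at hw
      congr 1
      ext y
      simp only [Finset.mem_inter, mem_neighborFinset, Finset.mem_filter]
      constructor
      · rintro ⟨hadj, hy⟩
        exact ⟨hadj, hy, hcl w y hw.2 hy hadj⟩
      · rintro ⟨hadj, hy, _⟩
        exact ⟨hadj, hy⟩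
    have hdeg2 : ∀ w ∈ S.filter (fun w => ¬ P w), (G.neighborFinset w ∩ S).card
        = (G.neighborFinset w ∩ S.filter (fun w => ¬ P w)).card := by
      intro w hw
      rw [Finset.mem_filter] at hw
      congr 1
      ext y
      simp only [Finset.mem_inter, mem_neighborFinset, Finset.mem_filter]
      constructor
      · rintro ⟨hadj, hy⟩
        exact ⟨hadj, hy, fun hPy => hw.2 (hcl y w hPy hw.1 hadj.symm)⟩
      · rintro ⟨hadj, hy, _⟩
        exact ⟨hadj, hy⟩
    have hsplit : ∑ w ∈ S, (G.neighborFinset w ∩ S).card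
        = ∑ w ∈ S.filter P, (G.neighborFinset w ∩ S.filter P).card
          + ∑ w ∈ S.filter (fun w => ¬ P w),
              (G.neighborFinset w ∩ S.filter (fun w => ¬ P w)).card := by
      rw [← Finset.sum_filter_add_sum_filter_not S P, Finset.sum_congr rfl hdeg1,
        Finset.sum_congr rfl hdeg2]
    have hcsplit : (S.filter P).card + (S.filter (fun w => ¬ P w)).card = S.card :=
      Finset.card_filter_add_card_filter_not P
    have hlt1 : (S.filter P).card < S.card := by
      apply Finset.card_lt_card
      exact Finset.filter_ssubset.mpr ⟨v, hv, hPv⟩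
    have hlt2 : (S.filter (fun w => ¬ P w)).card < S.card := by
      apply Finset.card_lt_card
      exact Finset.filter_ssubset.mpr ⟨u, hu, fun h => h hPu⟩
    have hfail1 : ¬ (a * (S.filter P).card
        < b * ∑ w ∈ S.filter P, (G.neighborFinset w ∩ S.filter P).card) := by
      intro h
      have := hmin (S.filter P) ⟨(Finset.filter_subset _ _).trans hSU, h⟩
      omega
    have hfail2 : ¬ (a * (S.filter (fun w => ¬ P w)).card
        < b * ∑ w ∈ S.filter (fun w => ¬ P w),
            (G.neighborFinset w ∩ S.filter (fun w => ¬ P w)).card) := by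
      intro h
      have := hmin (S.filter (fun w => ¬ P w)) ⟨(Finset.filter_subset _ _).trans hSU, h⟩
      omega
    push Not at hfail1 hfail2
    have : b * ∑ w ∈ S, (G.neighborFinset w ∩ S).card ≤ a * S.card := by
      rw [hsplit, ← hcsplit, Nat.mul_add, Nat.mul_add]
      exact Nat.add_le_add hfail1 hfail2
    omega

omit [Fintype V] [DecidableEq V] [DecidableRel G.Adj] in
/-- A chain of adjacent vertices `g 0 ~ g 1 ~ ⋯ ~ g n` with `g` injective on `[0, n]` is traced by
a path of length `n` whose support is `{g j : j ≤ n}`. [folklore] -/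
theorem exists_path_of_chain (g : ℕ → V) (n : ℕ)
    (hadj : ∀ j < n, G.Adj (g j) (g (j + 1)))
    (hinj : ∀ j₁ ≤ n, ∀ j₂ ≤ n, g j₁ = g j₂ → j₁ = j₂) :
    ∃ p : G.Walk (g 0) (g n), p.IsPath ∧ p.length = n ∧
      (∀ j ≤ n, p.getVert j = g j) ∧ (∀ w, w ∈ p.support ↔ ∃ j ≤ n, g j = w) := by
  -- first the walk with its `getVert` description
  have hwalk : ∀ (n : ℕ) (g : ℕ → V), (∀ j < n, G.Adj (g j) (g (j + 1))) →
      ∃ p : G.Walk (g 0) (g n), p.length = n ∧ ∀ j ≤ n, p.getVert j = g j := by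
    intro n
    induction n with
    | zero =>
      intro g _
      exact ⟨Walk.nil, rfl, fun j hj => by simp [Nat.le_zero.mp hj]⟩
    | succ n ih =>
      intro g hg
      obtain ⟨p, hpl, hpv⟩ := ih (fun j => g (j + 1)) (fun j hj => hg (j + 1) (by omega))
      have h0 : G.Adj (g 0) (g (0 + 1)) := hg 0 (by omega)
      refine ⟨Walk.cons h0 p, by simp [hpl], ?_⟩
      intro j hj
      rcases j with _ | j
      · simp
      · rw [Walk.getVert_cons_succ]
        exact hpv j (by omega)
  obtain ⟨p, hpl, hpv⟩ := hwalk n g hadj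
  have hsupp : ∀ w, w ∈ p.support ↔ ∃ j ≤ n, g j = w := by
    intro w
    rw [Walk.mem_support_iff_exists_getVert]
    rw [hpl]
    constructor
    · rintro ⟨j, hj, hjn⟩
      exact ⟨j, hjn, (hpv j hjn) ▸ hj⟩
    · rintro ⟨j, hjn, hj⟩
      exact ⟨j, (hpv j hjn).trans hj, hjn⟩
  refine ⟨p, ?_, hpl, hpv, hsupp⟩
  rw [← Walk.IsPath.getVert_injOn_iff]
  intro j₁ hj₁ j₂ hj₂ heq
  simp only [Set.mem_setOf_eq, hpl] at hj₁ hj₂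
  rw [hpv j₁ hj₁, hpv j₂ hj₂] at heq
  exact hinj j₁ hj₁ j₂ hj₂ heq

omit [Fintype V] [DecidableEq V] [DecidableRel G.Adj] in
/-- Colour propagation: if the end-vertices of every `S`-supported path of length `t` have the same
colour, so do the end-vertices of every `S`-supported path of length `q·t`. [folklore] -/
theorem colour_eq_of_length_mul {α : Type*} (c : V → α) (S : Finset V) (t : ℕ)
    (hc : ∀ {u v : V} (p : G.Walk u v), p.IsPath → p.length = t →
      (∀ x ∈ p.support, x ∈ S) → c u = c v) :
    ∀ (q : ℕ) {u v : V} (p : G.Walk u v), p.IsPath → p.length = q * t →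
      (∀ x ∈ p.support, x ∈ S) → c u = c v := by
  intro q
  induction q with
  | zero =>
    intro u v p _ hl _
    rw [zero_mul] at hl
    cases Walk.eq_of_length_eq_zero hl
    rfl
  | succ q ih =>
    intro u v p hp hl hS
    have hlen : t ≤ p.length := by rw [hl]; nlinarith
    have h1 : c u = c (p.getVert t) := by
      refine hc (p.take t) (hp.take t) ?_ ?_
      · rw [Walk.take_length]; exact Nat.min_eq_left hlen
      · intro x hx
        exact hS x ((p.isSubwalk_take t).support_subset hx)
    have h2 : c (p.getVert t) = c v := by
      refine ih (p.drop t) (hp.drop t) ?_ ?_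
      · rw [Walk.drop_length, hl]
        simp [Nat.succ_mul]
      · intro x hx
        exact hS x ((p.isSubwalk_drop t).support_subset hx)
    exact h1.trans h2

/-- Residue bookkeeping behind Lemma 1(ii) of Bondy–Simonovits: a colouring of `ℤ` that is
`t`-periodic and `L`-periodic and satisfies the two families of "chord" identities coming from the
θ-graph takes at most the two values `col 0`, `col 1`. [cite: BondySimonovits1974, Lemma 1 (ii)] -/
theorem two_values_of_shifts {α : Type*} (col : ℤ → α) (t L a : ℤ) (ht : 0 < t)
    (h1 : ∀ z, col (z + t) = col z) (h2 : ∀ z, col (z + L) = col z)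
    (h3 : ∀ j, 0 ≤ j → j < t → col j = col (a - t + 1 + j))
    (h4 : ∀ j, 0 ≤ j → j < t → col (-j) = col (a + t - 1 - j)) :
    ∀ z, col z = col 0 ∨ col z = col 1 := by
  -- multiples of `t` and `L`
  have hmul : ∀ (s : ℤ), (∀ z, col (z + s) = col z) → ∀ (k z : ℤ), col (z + k * s) = col z := by
    intro s hs k
    induction k using Int.induction_on with
    | zero => intro z; simp
    | succ k ih => intro z; rw [add_mul, one_mul, ← add_assoc, hs, ih]
    | pred k ih =>
      intro z
      have := hs (z + (-(k : ℤ) - 1) * s)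
      rw [← this]
      have e : z + (-(k : ℤ) - 1) * s + s = z + (-(k : ℤ)) * s := by ring
      rw [e, ih]
  have ht' := hmul t h1
  have hL' := hmul L h2
  -- the gcd
  set g : ℤ := (Int.gcd t L : ℤ) with hg
  have hgper : ∀ z, col (z + g) = col z := by
    intro z
    rw [hg, Int.gcd_eq_gcd_ab t L]
    have e : z + (t * Int.gcdA t L + L * Int.gcdB t L)
        = z + Int.gcdA t L * t + Int.gcdB t L * L := by ring
    rw [e, hL', ht']
  have hg' := hmul g hgper
  have hgpos : 0 < g := by
    rw [hg]; exact_mod_cast Int.gcd_pos_of_ne_zero_left L ht.ne'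
  have hgle : g ≤ t := by
    rw [hg]; exact Int.le_of_dvd ht (Int.gcd_dvd_left t L)
  -- reduction of any integer to a small residue
  have hred : ∀ z, ∃ j, 0 ≤ j ∧ j < t ∧ ∃ q : ℤ, z = j + q * g := by
    intro z
    refine ⟨z % g, Int.emod_nonneg z hgpos.ne', (Int.emod_lt_of_pos z hgpos).trans_le hgle,
      z / g, ?_⟩
    have := Int.emod_add_mul_ediv z g
    linarith [mul_comm g (z / g)]
  -- shift by `a + 1`
  have hA : ∀ z, col (z + (a + 1)) = col z := by
    intro z
    obtain ⟨j, hj0, hjt, q, rfl⟩ := hred z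
    have e1 : j + q * g + (a + 1) = (j + (a + 1)) + q * g := by ring
    rw [e1, hg', hg', h3 j hj0 hjt]
    have e2 : a - t + 1 + j = (j + (a + 1)) + (-1) * t := by ring
    rw [e2, ht']
  -- shift by `a - 1`
  have hB : ∀ z, col (z + (a - 1)) = col z := by
    intro z
    obtain ⟨j, hj0, hjt, q, hq⟩ := hred (-z)
    have hz : z = -j + (-q) * g := by linarith
    rw [hz]
    have e1 : -j + (-q) * g + (a - 1) = (-j + (a - 1)) + (-q) * g := by ring
    rw [e1, hg', hg', h4 j hj0 hjt]
    have e2 : a + t - 1 - j = (-j + (a - 1)) + 1 * t := by ring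
    rw [e2, ht']
  -- period two
  have h2per : ∀ z, col (z + 2) = col z := by
    intro z
    have := hB (z + 2)
    rw [← this]
    have e : z + 2 + (a - 1) = z + (a + 1) := by ring
    rw [e, hA]
  have h2' := hmul 2 h2per
  intro z
  have hz : z = z % 2 + (z / 2) * 2 := by omega
  rw [hz, h2']
  rcases Int.emod_two_eq_zero_or_one z with h | h
  · left; rw [h]
  · right; rw [h]

/-! ## The θ-graph and Lemma 1 -/

omit [Fintype V] [DecidableEq V] [DecidableRel G.Adj] in
/-- Periodicity bookkeeping for an `L`-periodic map `F : ℤ → V` that is injective on `[0, L)`: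
two arguments with the same value that lie in a common window of length `< L` are equal.
[folklore] -/
theorem window_inj_of_periodic (F : ℤ → V) (L : ℕ) (hL : 1 ≤ L) (hper : ∀ z, F (z + L) = F z)
    (hinj : ∀ z₁ z₂ : ℤ, 0 ≤ z₁ → z₁ < L → 0 ≤ z₂ → z₂ < L → F z₁ = F z₂ → z₁ = z₂) :
    ∀ z₁ z₂ : ℤ, F z₁ = F z₂ → z₁ - L < z₂ → z₂ < z₁ + L → z₁ = z₂ := by
  have hLpos : (0 : ℤ) < L := by exact_mod_cast hL
  -- multiples of the period
  have hperk : ∀ (k z : ℤ), F (z + k * L) = F z := by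
    intro k
    induction k using Int.induction_on with
    | zero => intro z; simp
    | succ k ih => intro z; rw [add_mul, one_mul, ← add_assoc, hper, ih]
    | pred k ih =>
      intro z
      have := hper (z + (-(k : ℤ) - 1) * L)
      rw [← this]
      have e : z + (-(k : ℤ) - 1) * L + L = z + (-(k : ℤ)) * L := by ring
      rw [e, ih]
  have hmodF : ∀ z, F z = F (z % L) := by
    intro z
    have h := Int.emod_add_mul_ediv z L
    have e : z % L = z + (-(z / L)) * L := by linarith [mul_comm (L : ℤ) (z / L)]
    rw [e, hperk]
  intro z₁ z₂ hF hlo hhi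
  rw [hmodF z₁, hmodF z₂] at hF
  have hm := hinj _ _ (Int.emod_nonneg _ hLpos.ne') (Int.emod_lt_of_pos _ hLpos)
    (Int.emod_nonneg _ hLpos.ne') (Int.emod_lt_of_pos _ hLpos) hF
  -- `z₁ ≡ z₂ (mod L)` and `|z₁ - z₂| < L`
  have h₁ := Int.emod_add_mul_ediv z₁ L
  have h₂ := Int.emod_add_mul_ediv z₂ L
  have hdiff : z₂ - z₁ = L * (z₂ / L - z₁ / L) := by rw [mul_sub]; linarith
  set k := z₂ / L - z₁ / L with hk
  rcases lt_trichotomy k 0 with hk0 | hk0 | hk0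
  · have : (L : ℤ) * k ≤ (L : ℤ) * (-1) := by
      exact mul_le_mul_of_nonneg_left (by linarith) hLpos.le
    linarith
  · rw [hk0, mul_zero] at hdiff; linarith
  · have : (L : ℤ) * 1 ≤ (L : ℤ) * k := by
      exact mul_le_mul_of_nonneg_left (by linarith) hLpos.le
    linarith

omit [Fintype V] [DecidableEq V] [DecidableRel G.Adj] in
/-- End-vertices of an index path have the same colour: if `m ↦ F (ψ m)` (`m ≤ t`) is a chain of
adjacent vertices with `ψ` injective and all `ψ`-values in a window of length `< L`, then the path
it traces is an `S`-supported path of length `t`, so a `t`-periodic colouring agrees on its ends.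
[folklore] -/
theorem colour_eq_of_index_path {α : Type*} (c : V → α) (S : Finset V) (t : ℕ)
    (hc : ∀ {u v : V} (p : G.Walk u v), p.IsPath → p.length = t →
      (∀ x ∈ p.support, x ∈ S) → c u = c v)
    (F : ℤ → V) (hFS : ∀ z, F z ∈ S) (L : ℕ)
    (hwin : ∀ z₁ z₂ : ℤ, F z₁ = F z₂ → z₁ - L < z₂ → z₂ < z₁ + L → z₁ = z₂)
    (ψ : ℕ → ℤ) (hψadj : ∀ m < t, G.Adj (F (ψ m)) (F (ψ (m + 1))))
    (hψinj : ∀ m₁ ≤ t, ∀ m₂ ≤ t, ψ m₁ = ψ m₂ → m₁ = m₂)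
    (hψwin : ∀ m₁ ≤ t, ∀ m₂ ≤ t, ψ m₂ < ψ m₁ + L) :
    c (F (ψ 0)) = c (F (ψ t)) := by
  obtain ⟨p, hp, hpl, -, hps⟩ := exists_path_of_chain (G := G) (fun m => F (ψ m)) t hψadj
    (by
      intro m₁ h₁ m₂ h₂ heq
      refine hψinj m₁ h₁ m₂ h₂ (hwin _ _ heq ?_ (hψwin m₁ h₁ m₂ h₂))
      have := hψwin m₂ h₂ m₁ h₁
      linarith)
  refine hc p hp hpl ?_
  intro x hx
  obtain ⟨j, -, rfl⟩ := (hps x).mp hx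
  exact hFS _

omit [Fintype V] [DecidableEq V] [DecidableRel G.Adj] in
/-- **Lemma 1 (ii) of Bondy–Simonovits**: on a θ-graph consisting of a cycle
`F 0 ~ F 1 ~ ⋯ ~ F (L-1) ~ F 0` and a chord `F 0 ~ F a` whose three paths have lengths `1`,
`a ≥ t`, `L - a ≥ t`, every colouring that is `t`-periodic (equal colours at the ends of every
`S`-supported path of length `t`, the θ-graph lying inside `S`) uses at most two colours.
[cite: BondySimonovits1974, Lemma 1 (ii)] -/
theorem theta_two_colours {α : Type*} (c : V → α) (S : Finset V) (t : ℕ) (ht : 1 ≤ t)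
    (hc : ∀ {u v : V} (p : G.Walk u v), p.IsPath → p.length = t →
      (∀ x ∈ p.support, x ∈ S) → c u = c v)
    (F : ℤ → V) (L a : ℕ) (hFS : ∀ z, F z ∈ S) (hper : ∀ z, F (z + L) = F z)
    (hinj : ∀ z₁ z₂ : ℤ, 0 ≤ z₁ → z₁ < L → 0 ≤ z₂ → z₂ < L → F z₁ = F z₂ → z₁ = z₂)
    (hadj : ∀ z, G.Adj (F z) (F (z + 1))) (hchord : G.Adj (F 0) (F a))
    (hta : t ≤ a) (htb : a + t ≤ L) :
    ∀ z, c (F z) = c (F 0) ∨ c (F z) = c (F 1) := by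
  have hL : 1 ≤ L := by omega
  have hwin := window_inj_of_periodic F L hL hper hinj
  have key := fun (ψ : ℕ → ℤ) => colour_eq_of_index_path (G := G) c S t hc F hFS L hwin ψ
  -- (1) periodicity along the cycle
  have h1 : ∀ z : ℤ, c (F (z + t)) = c (F z) := by
    intro z
    have := key (fun m => z + m)
      (by
        intro m _
        have e : z + ((m + 1 : ℕ) : ℤ) = z + m + 1 := by push_cast; ring
        rw [e]; exact hadj _)
      (by intro m₁ _ m₂ _ h; exact_mod_cast (add_left_cancel h))
      (by intro m₁ h₁ m₂ h₂; omega)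
    simpa using this.symm
  -- (2) chord identities of the first kind: `j, j-1, …, 0, a, a-1, …, a-t+1+j`
  have h3 : ∀ j : ℤ, 0 ≤ j → j < t → c (F j) = c (F (a - t + 1 + j)) := by
    intro j hj0 hjt
    obtain ⟨j, rfl⟩ := Int.eq_ofNat_of_zero_le hj0
    have hjt' : j < t := by exact_mod_cast hjt
    set ψ : ℕ → ℤ := fun m => if m ≤ j then (j : ℤ) - m else (a : ℤ) + j + 1 - m with hψ
    have hψadj : ∀ m < t, G.Adj (F (ψ m)) (F (ψ (m + 1))) := by
      intro m _
      simp only [hψ]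
      split_ifs with ha hb hb
      · have e : (j : ℤ) - m = (j : ℤ) - ((m + 1 : ℕ) : ℤ) + 1 := by push_cast; ring
        rw [e]; exact (hadj _).symm
      · have hmj : m = j := by omega
        subst hmj
        have e1 : (m : ℤ) - m = 0 := by ring
        have e2 : (a : ℤ) + m + 1 - ((m + 1 : ℕ) : ℤ) = a := by push_cast; ring
        rw [e1, e2]; exact hchord
      · exfalso; omega
      · have e : (a : ℤ) + j + 1 - m = (a : ℤ) + j + 1 - ((m + 1 : ℕ) : ℤ) + 1 := by
          push_cast; ring
        rw [e]; exact (hadj _).symm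
    have hψinj : ∀ m₁ ≤ t, ∀ m₂ ≤ t, ψ m₁ = ψ m₂ → m₁ = m₂ := by
      intro m₁ h₁ m₂ h₂ h
      simp only [hψ] at h
      split_ifs at h <;> omega
    have hψwin : ∀ m₁ ≤ t, ∀ m₂ ≤ t, ψ m₂ < ψ m₁ + L := by
      intro m₁ h₁ m₂ h₂
      simp only [hψ]
      split_ifs <;> omega
    have := key ψ hψadj hψinj hψwin
    have e0 : ψ 0 = j := by simp [hψ]
    have et : ψ t = a - t + 1 + j := by
      simp only [hψ, show ¬ (t ≤ j) from by omega, if_false]; ring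
    rw [e0, et] at this
    exact this
  -- (3) chord identities of the second kind: `-j, -j+1, …, 0, a, a+1, …, a+t-1-j`
  have h4 : ∀ j : ℤ, 0 ≤ j → j < t → c (F (-j)) = c (F (a + t - 1 - j)) := by
    intro j hj0 hjt
    obtain ⟨j, rfl⟩ := Int.eq_ofNat_of_zero_le hj0
    have hjt' : j < t := by exact_mod_cast hjt
    set ψ : ℕ → ℤ := fun m => if m ≤ j then (m : ℤ) - j else (a : ℤ) + m - j - 1 with hψ
    have hψadj : ∀ m < t, G.Adj (F (ψ m)) (F (ψ (m + 1))) := by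
      intro m _
      simp only [hψ]
      split_ifs with ha hb hb
      · have e : ((m + 1 : ℕ) : ℤ) - j = (m : ℤ) - j + 1 := by push_cast; ring
        rw [e]; exact hadj _
      · have hmj : m = j := by omega
        subst hmj
        have e1 : (m : ℤ) - m = 0 := by ring
        have e2 : (a : ℤ) + ((m + 1 : ℕ) : ℤ) - m - 1 = a := by push_cast; ring
        rw [e1, e2]; exact hchord
      · exfalso; omega
      · have e : (a : ℤ) + ((m + 1 : ℕ) : ℤ) - j - 1 = (a : ℤ) + m - j - 1 + 1 := by
          push_cast; ring
        rw [e]; exact hadj _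
    have hψinj : ∀ m₁ ≤ t, ∀ m₂ ≤ t, ψ m₁ = ψ m₂ → m₁ = m₂ := by
      intro m₁ h₁ m₂ h₂ h
      simp only [hψ] at h
      split_ifs at h <;> omega
    have hψwin : ∀ m₁ ≤ t, ∀ m₂ ≤ t, ψ m₂ < ψ m₁ + L := by
      intro m₁ h₁ m₂ h₂
      simp only [hψ]
      split_ifs <;> omega
    have := key ψ hψadj hψinj hψwin
    have e0 : ψ 0 = -j := by simp [hψ]
    have et : ψ t = a + t - 1 - j := by
      simp only [hψ, show ¬ (t ≤ j) from by omega, if_false]; ring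
    rw [e0, et] at this
    exact this
  -- (4) residues
  have h2 : ∀ z : ℤ, c (F (z + L)) = c (F z) := fun z => by rw [hper]
  exact two_values_of_shifts (fun z => c (F z)) t L a (by exact_mod_cast ht) h1 h2 h3 h4

/-- **Lemma 1 (i) of Bondy–Simonovits** (Pósa's longest-path argument): if every vertex of a
nonempty finite set `S` has at least `2t + 1` neighbours inside `S` (`t ≥ 1`), then `S` contains a
θ-graph: a cycle `F 0 ~ F 1 ~ ⋯ ~ F (L - 1) ~ F 0` (`F` is `L`-periodic and injective on a period)
together with a chord `F 0 ~ F a`, with `t ≤ a` and `a + t ≤ L`.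
[cite: BondySimonovits1974, Lemma 1 (i)] -/
theorem exists_theta (S : Finset V) (hS : S.Nonempty) (t : ℕ) (ht : 1 ≤ t)
    (hdeg : ∀ v ∈ S, 2 * t + 1 ≤ (G.neighborFinset v ∩ S).card) :
    ∃ (F : ℤ → V) (L a : ℕ), (∀ z, F z ∈ S) ∧ (∀ z, F (z + L) = F z) ∧
      (∀ z₁ z₂ : ℤ, 0 ≤ z₁ → z₁ < L → 0 ≤ z₂ → z₂ < L → F z₁ = F z₂ → z₁ = z₂) ∧
      (∀ z, G.Adj (F z) (F (z + 1))) ∧ G.Adj (F 0) (F a) ∧ t ≤ a ∧ a + t ≤ L := by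
  classical
  -- a longest `S`-supported path
  set lengths : Finset ℕ := (Finset.range (Fintype.card V)).filter (fun n =>
    ∃ (u v : V) (p : G.Walk u v), p.IsPath ∧ p.length = n ∧ ∀ x ∈ p.support, x ∈ S) with hlen
  obtain ⟨u₀, hu₀⟩ := hS
  have hne : lengths.Nonempty := by
    refine ⟨0, ?_⟩
    simp only [hlen, Finset.mem_filter, Finset.mem_range]
    refine ⟨Fintype.card_pos_iff.mpr ⟨u₀⟩, u₀, u₀, Walk.nil, Walk.IsPath.nil, rfl, ?_⟩
    intro x hx; simp only [Walk.support_nil, List.mem_singleton] at hx; exact hx ▸ hu₀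
  set n₀ := lengths.max' hne with hn₀
  have hn₀mem : n₀ ∈ lengths := Finset.max'_mem _ _
  simp only [hlen, Finset.mem_filter, Finset.mem_range] at hn₀mem
  obtain ⟨-, u, v, P, hP, hPl, hPS⟩ := hn₀mem
  have hmax : ∀ (u' v' : V) (p : G.Walk u' v'), p.IsPath → (∀ x ∈ p.support, x ∈ S) →
      p.length ≤ n₀ := by
    intro u' v' p hp hps
    apply Finset.le_max'
    simp only [hlen, Finset.mem_filter, Finset.mem_range]
    exact ⟨hp.length_lt, u', v', p, hp, rfl, hps⟩
  have huS : u ∈ S := hPS u P.start_mem_support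
  -- every `S`-neighbour of `u` lies on `P`
  have hnbr : ∀ w, G.Adj u w → w ∈ S → w ∈ P.support := by
    intro w hadj hw
    by_contra hws
    have hp' : (Walk.cons hadj.symm P).IsPath := (Walk.cons_isPath_iff _ _).mpr ⟨hP, hws⟩
    have := hmax _ _ _ hp' (by
      intro x hx
      rw [Walk.support_cons] at hx
      rcases List.mem_cons.mp hx with rfl | hx
      · exact hw
      · exact hPS x hx)
    simp [hPl] at this
  -- the index set of the neighbours of `u` on `P`
  set I : Finset ℕ := (Finset.range (n₀ + 1)).filter (fun i => G.Adj u (P.getVert i)) with hI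
  have hIcard : 2 * t + 1 ≤ I.card := by
    refine (hdeg u huS).trans ?_
    have hsub : G.neighborFinset u ∩ S ⊆ I.image P.getVert := by
      intro w hw
      rw [Finset.mem_inter, mem_neighborFinset] at hw
      obtain ⟨i, hi, hin⟩ := Walk.mem_support_iff_exists_getVert.mp (hnbr w hw.1 hw.2)
      refine Finset.mem_image.mpr ⟨i, ?_, hi⟩
      simp only [hI, Finset.mem_filter, Finset.mem_range]
      exact ⟨by rw [hPl] at hin; omega, hi ▸ hw.1⟩
    exact (Finset.card_le_card hsub).trans Finset.card_image_le
  have hI0 : ∀ i ∈ I, 1 ≤ i := by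
    intro i hi
    simp only [hI, Finset.mem_filter, Finset.mem_range] at hi
    by_contra h0
    have : i = 0 := by omega
    rw [this, Walk.getVert_zero] at hi
    exact G.irrefl hi.2
  have hIle : ∀ i ∈ I, i ≤ n₀ := by
    intro i hi
    simp only [hI, Finset.mem_filter, Finset.mem_range] at hi
    omega
  have hIadj : ∀ i ∈ I, G.Adj u (P.getVert i) := by
    intro i hi
    simp only [hI, Finset.mem_filter, Finset.mem_range] at hi
    exact hi.2
  -- the index `A ≥ t`, minimal among those
  have hAt : (I.filter (fun i => t ≤ i)).Nonempty := by
    by_contra hemp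
    rw [Finset.not_nonempty_iff_eq_empty, Finset.filter_eq_empty_iff] at hemp
    have hsub : I ⊆ Finset.Ico 1 t := by
      intro i hi
      rw [Finset.mem_Ico]
      exact ⟨hI0 i hi, by have := hemp hi; omega⟩
    have := Finset.card_le_card hsub
    rw [Nat.card_Ico] at this
    omega
  set A := (I.filter (fun i => t ≤ i)).min' hAt with hA
  have hAmem : A ∈ I.filter (fun i => t ≤ i) := Finset.min'_mem _ _
  rw [Finset.mem_filter] at hAmem
  have hAmin : ∀ i ∈ I, i < A → i < t := by
    intro i hi hiA
    by_contra hit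
    have : A ≤ i := Finset.min'_le _ _ (Finset.mem_filter.mpr ⟨hi, by omega⟩)
    omega
  -- the index `B ≥ A + t`
  have hBt : (I.filter (fun i => A + t ≤ i)).Nonempty := by
    by_contra hemp
    rw [Finset.not_nonempty_iff_eq_empty, Finset.filter_eq_empty_iff] at hemp
    have hsub : I ⊆ Finset.Ico 1 t ∪ Finset.Ico A (A + t) := by
      intro i hi
      rw [Finset.mem_union, Finset.mem_Ico, Finset.mem_Ico]
      by_cases hiA : i < A
      · exact Or.inl ⟨hI0 i hi, hAmin i hi hiA⟩
      · exact Or.inr ⟨by omega, by have := hemp hi; omega⟩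
    have := (Finset.card_le_card hsub).trans (Finset.card_union_le _ _)
    rw [Nat.card_Ico, Nat.card_Ico] at this
    omega
  obtain ⟨B, hB⟩ := hBt
  rw [Finset.mem_filter] at hB
  obtain ⟨hBI, hAB⟩ := hB
  have hBn : B ≤ n₀ := hIle B hBI
  -- the θ-graph
  set L : ℕ := B + 1 with hL
  have hLpos : (0 : ℤ) < L := by simp [hL]
  refine ⟨fun z => P.getVert (z % L).toNat, L, A, ?_, ?_, ?_, ?_, ?_, hAmem.2, by omega⟩
  · intro z; exact hPS _ (Walk.getVert_mem_support _ _)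
  · intro z; simp
  · intro z₁ z₂ h1 h1' h2 h2' heq
    simp only at heq
    rw [Int.emod_eq_of_lt h1 h1', Int.emod_eq_of_lt h2 h2'] at heq
    have hi := hP.getVert_injOn (by
        show z₁.toNat ∈ {i | i ≤ P.length}
        simp only [Set.mem_setOf_eq, hPl]; omega)
      (by
        show z₂.toNat ∈ {i | i ≤ P.length}
        simp only [Set.mem_setOf_eq, hPl]; omega) heq
    omega
  · intro z
    simp only
    have hm0 : 0 ≤ z % L := Int.emod_nonneg _ hLpos.ne'
    have hmL : z % L < L := Int.emod_lt_of_pos _ hLpos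
    set m := (z % L).toNat with hm
    have hmz : (m : ℤ) = z % L := Int.toNat_of_nonneg hm0
    have hdecomp := Int.emod_add_mul_ediv z L
    have hz1 : (z + 1) % L = ((m : ℤ) + 1) % L := by
      rw [hmz]
      conv_lhs => rw [← hdecomp]
      rw [add_right_comm, Int.add_mul_emod_self_left]
    by_cases hmB : m < B
    · have hz1' : (z + 1) % L = (m : ℤ) + 1 := by
        rw [hz1]; apply Int.emod_eq_of_lt (by omega)
        simp [hL]; omega
      rw [hz1']
      have e : ((m : ℤ) + 1).toNat = m + 1 := by
        have : ((m : ℤ) + 1) = ((m + 1 : ℕ) : ℤ) := by push_cast; ring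
        rw [this, Int.toNat_natCast]
      rw [e]
      exact P.adj_getVert_succ (by rw [hPl]; omega)
    · have hmB' : m = B := by
        have : (m : ℤ) < L := by rw [hmz]; exact hmL
        simp [hL] at this; omega
      have hz1' : (z + 1) % L = 0 := by
        rw [hz1, hmB']
        have : ((B : ℤ) + 1) = (L : ℤ) := by simp [hL]
        rw [this, Int.emod_self]
      rw [hz1', Int.toNat_zero, Walk.getVert_zero, hmB']
      exact (hIadj B hBI).symm
  · simp only [Int.zero_emod, Int.toNat_zero, Walk.getVert_zero]
    have hA' : ((A : ℤ) % L).toNat = A := by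
      rw [Int.emod_eq_of_lt (by positivity) (by simp [hL]; omega), Int.toNat_natCast]
    rw [hA']
    exact hIadj A hAmem.1

/-- **Lemma 1 of Bondy–Simonovits** (relative form). Let `S` be a nonempty vertex set that is
connected through `S`-supported walks and in which every vertex has at least `2t + 1` neighbours
(`t ≥ 1`; the printed hypothesis `e > 2t·v` is used in the paper exactly to pass to such an `S`).
Then any colouring that gives equal colours to the end-vertices of every `S`-supported path of
length `t` (a "`t`-periodic colouring") uses at most two colours on `S`.
[cite: BondySimonovits1974, Lemma 1] -/
theorem lemma1 {α : Type*} (S : Finset V) (hS : S.Nonempty) (t : ℕ) (ht : 1 ≤ t)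
    (hdeg : ∀ v ∈ S, 2 * t + 1 ≤ (G.neighborFinset v ∩ S).card)
    (hconn : ∀ u ∈ S, ∀ v ∈ S, ∃ p : G.Walk u v, ∀ x ∈ p.support, x ∈ S)
    (c : V → α)
    (hc : ∀ {u v : V} (p : G.Walk u v), p.IsPath → p.length = t →
      (∀ x ∈ p.support, x ∈ S) → c u = c v) :
    ∃ c₁ c₂ : α, ∀ y ∈ S, c y = c₁ ∨ c y = c₂ := by
  classical
  obtain ⟨F, L, a, hFS, hper, hinj, hadj, hchord, hta, htb⟩ := exists_theta S hS t ht hdeg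
  have hL : 1 ≤ L := by omega
  have hwin := window_inj_of_periodic F L hL hper hinj
  have htwo := theta_two_colours (G := G) c S t ht hc F L a hFS hper hinj hadj hchord hta htb
  refine ⟨c (F 0), c (F 1), ?_⟩
  intro y hy
  -- a shortest `S`-supported walk from `y` to the θ-graph
  have hex : ∃ d, ∃ (z : ℤ) (p : G.Walk y (F z)), p.length = d ∧ ∀ x ∈ p.support, x ∈ S := by
    obtain ⟨p, hp⟩ := hconn y hy (F 0) (hFS 0)
    exact ⟨p.length, 0, p, rfl, hp⟩
  set d₀ := Nat.find hex with hd₀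
  obtain ⟨z₀, p₀, hp₀l, hp₀S⟩ := Nat.find_spec hex
  have hmin : ∀ (z : ℤ) (p : G.Walk y (F z)), (∀ x ∈ p.support, x ∈ S) → d₀ ≤ p.length := by
    intro z p hp
    exact Nat.find_min' hex ⟨z, p, rfl, hp⟩
  have hp₀ : p₀.IsPath := by
    by_contra hnp
    have hle := p₀.length_bypass_le_length
    have hne : p₀.bypass.length ≠ p₀.length := by
      intro h
      have := p₀.bypass_eq_self_of_length_le_length_bypass h.ge
      exact hnp (this ▸ p₀.bypass_isPath)
    have := hmin z₀ p₀.bypass (fun x hx => hp₀S x (p₀.support_bypass_subset_support hx))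
    omega
  -- vertices of the θ-graph near `F z₀` are not on `p₀`
  have havoid : ∀ m : ℕ, 1 ≤ m → m < L → F (z₀ + m) ∉ p₀.support := by
    intro m hm1 hmL hmem
    have hne : F (z₀ + m) ≠ F z₀ := by
      intro h
      have := hwin _ _ h (by omega) (by omega)
      omega
    have hlt := p₀.length_takeUntil_lt_length hmem hne
    have := hmin (z₀ + m) (p₀.takeUntil _ hmem)
      (fun x hx => hp₀S x (p₀.support_takeUntil_subset_support hmem hx))
    omega
  -- round the length up to a multiple of `t`
  obtain ⟨q, r, hr, hqr⟩ : ∃ q r : ℕ, r < t ∧ d₀ + r = q * t := by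
    have hd := Nat.div_add_mod d₀ t
    by_cases h0 : d₀ % t = 0
    · exact ⟨d₀ / t, 0, by omega, by rw [h0] at hd; linarith⟩
    · refine ⟨d₀ / t + 1, t - d₀ % t, by omega, ?_⟩
      have := Nat.mod_lt d₀ (by omega : 0 < t)
      have e : d₀ + (t - d₀ % t) = t * (d₀ / t) + t := by omega
      rw [e]; ring
  -- the arc `F z₀, F (z₀+1), …, F (z₀+r)`
  obtain ⟨arc, harc, harcl, -, harcs⟩ := exists_path_of_chain (G := G) (fun m => F (z₀ + m)) r
    (by
      intro m _
      have e : z₀ + ((m + 1 : ℕ) : ℤ) = z₀ + m + 1 := by push_cast; ring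
      rw [e]; exact hadj _)
    (by
      intro m₁ h₁ m₂ h₂ heq
      have := hwin _ _ heq (by omega) (by omega)
      omega)
  set arc' : G.Walk (F z₀) (F (z₀ + r)) := arc.copy (by simp) rfl with harc'
  have harc'p : arc'.IsPath := by rw [harc']; simpa using harc
  have hmeet : ∀ x ∈ p₀.support, x ∈ arc'.support → x = F z₀ := by
    intro x hx hx'
    rw [harc', Walk.support_copy] at hx'
    obtain ⟨m, hm, rfl⟩ := (harcs x).mp hx'
    rcases Nat.eq_zero_or_pos m with rfl | hmpos
    · simp
    · exact absurd hx (havoid m hmpos (by omega))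
  have hP : (p₀.append arc').IsPath := by
    -- two paths meeting only at the junction vertex concatenate to a path
    rw [Walk.isPath_def, Walk.support_append]
    have hqn := harc'p.support_nodup
    rw [← arc'.cons_tail_support, List.nodup_cons] at hqn
    refine List.Nodup.append hp₀.support_nodup hqn.2 ?_
    intro x hxp hxq
    exact hqn.1 ((hmeet x hxp (List.mem_of_mem_tail hxq)) ▸ hxq)
  have hPl : (p₀.append arc').length = q * t := by
    rw [Walk.length_append, harc', Walk.length_copy, harcl, hp₀l, hqr]
  have hPS : ∀ x ∈ (p₀.append arc').support, x ∈ S := by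
    intro x hx
    rw [Walk.support_append] at hx
    rcases List.mem_append.mp hx with hx | hx
    · exact hp₀S x hx
    · rw [harc', Walk.support_copy] at hx
      obtain ⟨m, -, rfl⟩ := (harcs x).mp (List.mem_of_mem_tail hx)
      exact hFS _
  have := colour_eq_of_length_mul (G := G) c S t hc q _ hP hPl hPS
  rw [this]
  exact htwo _

omit [Fintype V] [DecidableEq V] [DecidableRel G.Adj] in
/-- Three-point form of Lemma 1's conclusion: with at most two colours on `S`, among any three
vertices of `S` two have the same colour. [folklore] -/
theorem two_of_three {α : Type*} {S : Finset V} {c : V → α}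
    (h : ∃ c₁ c₂ : α, ∀ y ∈ S, c y = c₁ ∨ c y = c₂) {y₁ y₂ y₃ : V}
    (h₁ : y₁ ∈ S) (h₂ : y₂ ∈ S) (h₃ : y₃ ∈ S) :
    c y₁ = c y₂ ∨ c y₁ = c y₃ ∨ c y₂ = c y₃ := by
  obtain ⟨c₁, c₂, hc⟩ := h
  rcases hc y₁ h₁ with e₁ | e₁ <;> rcases hc y₂ h₂ with e₂ | e₂ <;>
    rcases hc y₃ h₃ with e₃ | e₃ <;> simp [e₁, e₂, e₃]

end BondySimonovits1974

end Literature.Combinatorics.SimpleGraph
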